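import Literature.MathematicalPhysics.QuantumLattice.GrassmannLaplacianTruncatedBound
import Literature.Probability.LatticeModels.SubmultiplicativeTreeWeight
import HarnessLib

/-!
# The decay-weighted `L¹–L^∞` bound for the truncated expectation of kernel vertices

Topic `Literature/MathematicalPhysics/QuantumLattice`; the WEIGHTED form of `GrassmannLaplacianTruncatedBound.lean`
(Benfatto–Giuliani–Mastropietro 2006, (2.66)–(2.80) and §3 (3.2)–(3.8): position-space moments of the kernels of
the effective potentials; Gentile–Mastropietro 2001, §4).  For a tree weight `wt` on label sets
(`SubmultiplicativeTreeWeight.lean`: `1 ≤ wt`, monotone, submultiplicative on overlapping unions — e.g.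
`(1 + γ^h diam)^N`), the kernels of the truncated expectation `𝓔ᵀ_C(M_0,…,M_{n-1})` of even kernel vertices obey
the bound of `sum_norm_kernel_ursellOf_kernelVertex_le` WITH THE OUTPUT LABEL SET WEIGHTED BY `wt`, provided the
input kernels are measured in the `wt`-weighted anchored `L¹` norms and the row and column sums of the
type-restricted covariances are taken against the pair weights `wt {X, Y}`:

`Σ_{W : W_i = w} wt(W) ‖kernel_r 𝓔ᵀ (W)‖ ≤ (r!)⁻¹ N^{(r)} κ^{N-r-2(n-1)} (∏_v ‖K_v‖_{1,∞;wt}) λ^{-(n-1)} ∏_ℓ (1 + λ α_wt m m'_ℓ)`.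

Mechanism: in each term of the tree expansion the output labels are labels of the input vertices, and all the
vertices are joined by the anchored tree, so `wt(output) ≤ ∏_v wt(labels of v) · ∏_{tree lines} wt{endpoints}`
(`IsTreeWeight.wt_image_le_prod`); the weighted term is then the unweighted term of the weighted kernels
`‖K_v‖·wt` and the weighted covariance entries `‖C(X,Y)‖·wt{X,Y}`, to which the unweighted lemmas apply verbatim.

* `image_subset_of_patWeight_map_ext_ne_zero` (the derivative steps extract output labels FROM the positions),
  `sum_filter_wt_mul_patWeight_map_ext_le`;
* `sum_wt_kerProd_mul_lapWt_le` (one consistent pattern), `sum_kerProd_sum_wt_patWeight_le` (one pattern),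
  `sum_wt_sum_norm_kernel_treeFactor_le` (one script), **`sum_wt_norm_kernel_ursellOf_kernelVertex_le`** (the bound).

Everything is proved; no definition (the weighted kernels and covariances are written inline).

## Sources

G. Benfatto, A. Giuliani, V. Mastropietro, Ann. Henri Poincaré 7 (2006) 809–898, (2.66)–(2.80), §3 (3.2)–(3.8)
(`BenfattoGiulianiMastropietro2006`); G. Gentile, V. Mastropietro, Phys. Rep. 352 (2001) 273–437, §4
(`GentileMastropietro2001`); K. Gawȩdzki, A. Kupiainen, Comm. Math. Phys. 102 (1985) 1–30 (`GawedzkiKupiainen1985GrossNeveu`).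
-/

noncomputable section

namespace Literature.MathematicalPhysics.QuantumLattice

open GrassmannAlgebra Finset MvPolynomial Literature.RingTheory.MvPolynomial
open Literature.Probability.LatticeModels Literature.Probability.LatticeModels.BattleFederbush
open Literature.MeasureTheory.Integral
open scoped InnerProductSpace

variable {𝕜 : Type*} [RCLike 𝕜] {Γ : Type*} [Fintype Γ] [DecidableEq Γ] {n : ℕ}
variable (C : Matrix Γ Γ 𝕜) (cl : Γ → Fin n) {deg : Fin n → ℕ} (K : ∀ v : Fin n, (Fin (deg v) → Γ) → 𝕜)
variable {wt : Finset Γ → ℝ}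

/-! ### Output labels are labels of the positions -/

omit [Fintype Γ] in
/-- **The derivative steps extract the output labels from the positions**: if the weight of the steps
`∂_{W_0} ⋯ ∂_{W_{r-1}}` against the labelling `Z` is non-zero then every `W_j` is one of the labels `Z_p`. [folklore] -/
theorem image_subset_of_patWeight_map_ext_ne_zero {N : ℕ} (Z : Fin N → Γ) {r : ℕ} (W : Fin r → Γ) (π : List (Fin N × Fin N))
    (h : patWeight Z ((List.ofFn W).map DelOp.ext : List (DelOp Γ 𝕜)) π ≠ 0) : univ.image W ⊆ univ.image Z := by
  rw [patWeight_map_ext] at h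
  intro a ha
  obtain ⟨j, -, rfl⟩ := mem_image.1 ha
  have hj : ((π[(j : ℕ)]?).map fun pq => Z pq.1) = some (W j) := by
    by_contra hne
    exact h (prod_eq_zero (mem_univ j) (if_neg hne))
  cases hπ : π[(j : ℕ)]? with
  | none => rw [hπ] at hj; simp at hj
  | some pq =>
    rw [hπ, Option.map_some, Option.some.injEq] at hj
    exact mem_image.2 ⟨pq.1, mem_univ _, hj⟩

/-- **The weighted output-label sum with one slot pinned**: for a tree weight,
`Σ_{W : W_i = w} wt(W) weight(Z, ∂_W, π) ≤ wt(Z) [Z_{p_i} = w]`. [folklore] -/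
theorem sum_filter_wt_mul_patWeight_map_ext_le (hwt : IsTreeWeight wt) {N : ℕ} (Z : Fin N → Γ) {r : ℕ} (i : Fin r) (w : Γ)
    (π : List (Fin N × Fin N)) :
    ∑ W ∈ univ.filter (fun W : Fin r → Γ => W i = w), wt (univ.image W) * patWeight Z ((List.ofFn W).map DelOp.ext : List (DelOp Γ 𝕜)) π ≤
      wt (univ.image Z) * (if (π[(i : ℕ)]?).map (fun pq => Z pq.1) = some w then 1 else 0) := by
  calc ∑ W ∈ univ.filter (fun W : Fin r → Γ => W i = w), wt (univ.image W) * patWeight Z ((List.ofFn W).map DelOp.ext : List (DelOp Γ 𝕜)) π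
      ≤ ∑ W ∈ univ.filter (fun W : Fin r → Γ => W i = w), wt (univ.image Z) * patWeight Z ((List.ofFn W).map DelOp.ext : List (DelOp Γ 𝕜)) π := by
        refine sum_le_sum fun W _ => ?_
        by_cases h : patWeight Z ((List.ofFn W).map DelOp.ext : List (DelOp Γ 𝕜)) π = 0
        · rw [h, mul_zero, mul_zero]
        · exact mul_le_mul_of_nonneg_right (hwt.mono (image_subset_of_patWeight_map_ext_ne_zero Z W π h)) (patWeight_nonneg _ _ _)
    _ ≤ wt (univ.image Z) * (if (π[(i : ℕ)]?).map (fun pq => Z pq.1) = some w then 1 else 0) := by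
        rw [← mul_sum]
        exact mul_le_mul_of_nonneg_left (sum_filter_patWeight_map_ext_le Z i w π) (hwt.nonneg _)

/-! ### One consistent pattern: the weighted tree-decay lemma -/

section TreeDecay

omit [Fintype Γ] in
/-- The labels at the positions of a vertex. [folklore] -/
theorem image_filter_vert_eq (x : Fin (∑ v, deg v) → Γ) (u : Fin n) :
    (univ.filter fun τ : Fin (∑ v, deg v) => vert deg τ = u).image x = univ.image fun j : Fin (deg u) => x (blockEmb deg u j) := by
  ext a
  simp only [mem_image, mem_filter, mem_univ, true_and]
  constructor
  · rintro ⟨τ, hτ, rfl⟩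
    obtain ⟨j, rfl⟩ := exists_eq_blockEmb deg hτ
    exact ⟨j, rfl⟩
  · rintro ⟨j, rfl⟩
    exact ⟨blockEmb deg u j, vert_blockEmb deg u j, rfl⟩

/-- **The weighted tree-decay lemma for one script and one consistent pattern**: for a tree weight `wt`, a valid
script rooted at `v₀` covering all the vertices, a position `p₀` of the root cluster pinned at `w`, kernels with
`wt`-weighted anchored `L¹` norms `≤ N_u` and type-restricted covariances whose `wt`-weighted row and column sums
are at most `α`,
`Σ_{x : x_{p₀} = w} wt(x) ∏_u ‖K_u(x|_u)‖ · lapWt(lines, π, x) ≤ (α/2)^k ∏_u N_u`. [cite: BenfattoGiulianiMastropietro2006, §3 (3.2)-(3.8)] -/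
theorem sum_wt_kerProd_mul_lapWt_le (hwt : IsTreeWeight wt) (Nv : Fin n → ℝ) (hN0 : ∀ u, 0 ≤ Nv u)
    (hN : ∀ u (j : Fin (deg u)) (a : Γ), ∑ Yu ∈ univ.filter (fun Yu : Fin (deg u) → Γ => Yu j = a), ‖K u Yu‖ * wt (univ.image Yu) ≤ Nv u)
    {α : ℝ} (hα : 0 ≤ α) (hrow : ∀ ℓ X, ∑ Y, ‖typeRestrict C cl ℓ X Y‖ * wt {X, Y} ≤ α)
    (hcol : ∀ ℓ Y, ∑ X, ‖typeRestrict C cl ℓ X Y‖ * wt {X, Y} ≤ α)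
    {v₀ : Fin n} {k : ℕ} (s : Script v₀ k) (hs : s.Valid) (hcov : univ.image s.y = univ)
    (π : List (Fin (∑ v, deg v) × Fin (∑ v, deg v))) (p₀ : Fin (∑ v, deg v)) (hp₀ : vert deg p₀ = v₀) (w : Γ) :
    ∑ x ∈ univ.filter (fun x : Fin (∑ v, deg v) → Γ => x p₀ = w), wt (univ.image x) * (kerProd K x * lapWt C cl deg s.lines.reverse π x) ≤
      (α / 2) ^ k * ∏ u, Nv u := by
  -- the weighted kernels and covariance
  set Kw : ∀ v : Fin n, (Fin (deg v) → Γ) → 𝕜 := fun u Yu => (((‖K u Yu‖ * wt (univ.image Yu) : ℝ)) : 𝕜) with hKw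
  set Cw : Matrix Γ Γ 𝕜 := Matrix.of fun X Y => C X Y * ((wt {X, Y} : ℝ) : 𝕜) with hCw
  have hKw_norm : ∀ u Yu, ‖Kw u Yu‖ = ‖K u Yu‖ * wt (univ.image Yu) := fun u Yu => by
    rw [hKw]; dsimp only
    rw [RCLike.norm_ofReal, abs_of_nonneg (mul_nonneg (norm_nonneg _) (hwt.nonneg _))]
  have hCw_norm : ∀ ℓ X Y, ‖typeRestrict Cw cl ℓ X Y‖ = ‖typeRestrict C cl ℓ X Y‖ * wt {X, Y} := fun ℓ X Y => by
    simp only [typeRestrict_apply, hCw, Matrix.of_apply]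
    split_ifs
    · rw [norm_mul, RCLike.norm_ofReal, abs_of_nonneg (hwt.nonneg _)]
    · rw [norm_zero, zero_mul]
  have hkerw : ∀ x : Fin (∑ v, deg v) → Γ, kerProd Kw x = kerProd K x * ∏ u, wt (univ.image fun j : Fin (deg u) => x (blockEmb deg u j)) := by
    intro x
    rw [kerProd, kerProd, ← prod_mul_distrib]
    exact prod_congr rfl fun u _ => hKw_norm u _
  have hnd : s.lines.reverse.Nodup := List.nodup_reverse.2 (Script.nodup_lines s hs)
  -- the pointwise domination
  have hpt : ∀ x : Fin (∑ v, deg v) → Γ, wt (univ.image x) * (kerProd K x * lapWt C cl deg s.lines.reverse π x) ≤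
      kerProd Kw x * lapWt Cw cl deg s.lines.reverse π x := by
    intro x
    have hR0 : 0 ≤ kerProd Kw x * lapWt Cw cl deg s.lines.reverse π x := mul_nonneg (kerProd_nonneg Kw x) (lapWt_nonneg Cw cl deg _ _ _)
    by_cases hc : stepsOK (s.lines.reverse.map (lapPred deg)) π = true
    swap
    · rw [lapWt_eq C cl x _ π hnd, if_neg hc, mul_zero, mul_zero]; exact hR0
    -- the slots of the lines
    set e : Sym2 (Fin n) → Fin (∑ v, deg v) × Fin (∑ v, deg v) := fun ℓ =>
      match (s.lines.reverse.zip π).find? (fun z => decide (z.1 = ℓ)) with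
      | some z => (z.2.2, z.2.1)
      | none => (p₀, p₀) with he
    have he' : ∀ ℓ ∈ s.lines, ∃ pq, (s.lines.reverse.zip π).find? (fun z => decide (z.1 = ℓ)) = some (ℓ, pq) ∧
        s(vert deg pq.2, vert deg pq.1) = ℓ ∧ e ℓ = (pq.2, pq.1) := by
      intro ℓ hℓ
      obtain ⟨pq, hfind, hpq⟩ := exists_find_of_stepsOK (deg := deg) s.lines.reverse π hc ℓ (List.mem_reverse.2 hℓ)
      refine ⟨pq, hfind, hpq, ?_⟩
      simp only [he, hfind]
    have hev : ∀ ℓ ∈ s.lines, s(vert deg (e ℓ).1, vert deg (e ℓ).2) = ℓ := by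
      intro ℓ hℓ
      obtain ⟨pq, -, hpq, heq⟩ := he' ℓ hℓ
      rw [heq]; exact hpq
    -- the line weights of the weighted covariance
    have hline : ∀ ℓ ∈ s.lines.reverse, lineWt Cw cl (s.lines.reverse.zip π) ℓ x = lineWt C cl (s.lines.reverse.zip π) ℓ x * wt {x (e ℓ).1, x (e ℓ).2} := by
      intro ℓ hℓ
      obtain ⟨pq, hfind, -, heq⟩ := he' ℓ (List.mem_reverse.1 hℓ)
      rw [lineWt, lineWt, hfind, heq]
      dsimp only
      rw [hCw_norm, mul_assoc]
    have hlap : lapWt Cw cl deg s.lines.reverse π x = lapWt C cl deg s.lines.reverse π x * (s.lines.reverse.map fun ℓ => wt {x (e ℓ).1, x (e ℓ).2}).prod := by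
      rw [lapWt_eq Cw cl x _ π hnd, lapWt_eq C cl x _ π hnd, if_pos hc, if_pos hc, List.map_congr_left hline, List.prod_map_mul]
    -- the tree product bound
    have htree := hwt.wt_image_le_prod (vert deg) x e s hs hev
    have hfilt : (univ.filter fun τ : Fin (∑ v, deg v) => vert deg τ ∈ univ.image s.y) = univ := by
      rw [hcov]; exact filter_true_of_mem fun τ _ => mem_univ _
    rw [hfilt, hcov, ← List.prod_reverse, ← List.map_reverse] at htree
    simp only [image_filter_vert_eq] at htree
    have hK0 := kerProd_nonneg K x
    have hL0 := lapWt_nonneg C cl deg s.lines.reverse π x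
    have hP0 : 0 ≤ ∏ u, wt (univ.image fun j : Fin (deg u) => x (blockEmb deg u j)) := prod_nonneg fun u _ => hwt.nonneg _
    have hM0 : 0 ≤ (s.lines.reverse.map fun ℓ => wt {x (e ℓ).1, x (e ℓ).2}).prod := hwt.prod_map_nonneg s.lines.reverse _
    rw [hkerw, hlap]
    calc wt (univ.image x) * (kerProd K x * lapWt C cl deg s.lines.reverse π x)
        ≤ ((∏ u, wt (univ.image fun j : Fin (deg u) => x (blockEmb deg u j))) * (s.lines.reverse.map fun ℓ => wt {x (e ℓ).1, x (e ℓ).2}).prod) *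
            (kerProd K x * lapWt C cl deg s.lines.reverse π x) := mul_le_mul_of_nonneg_right htree (mul_nonneg hK0 hL0)
      _ = kerProd K x * (∏ u, wt (univ.image fun j : Fin (deg u) => x (blockEmb deg u j))) *
            (lapWt C cl deg s.lines.reverse π x * (s.lines.reverse.map fun ℓ => wt {x (e ℓ).1, x (e ℓ).2}).prod) := by ring
  -- the unweighted lemma for the weighted data
  have hN' : ∀ u (j : Fin (deg u)) (a : Γ), ∑ Yu ∈ univ.filter (fun Yu : Fin (deg u) → Γ => Yu j = a), ‖Kw u Yu‖ ≤ Nv u := by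
    intro u j a; simp only [hKw_norm]; exact hN u j a
  have hrow' : ∀ ℓ X, ∑ Y, ‖typeRestrict Cw cl ℓ X Y‖ ≤ α := fun ℓ X => by simp only [hCw_norm]; exact hrow ℓ X
  have hcol' : ∀ ℓ Y, ∑ X, ‖typeRestrict Cw cl ℓ X Y‖ ≤ α := fun ℓ Y => by simp only [hCw_norm]; exact hcol ℓ Y
  exact (sum_le_sum fun x _ => hpt x).trans (sum_kerProd_mul_lapWt_le Cw cl Kw Nv hN0 hN' hα hrow' hcol' s hs hcov π p₀ hp₀ w)

/-- **The weighted label sum of one pattern of one script** (output slot `i` pinned at `w`, tree rooted at `cl w`):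
`Σ_Y ∏‖K‖ Σ_{W : W_i = w} wt(W) weight(flat Y, ops_W(s), π) ≤ [π admissible] (α/2)^k ∏_u N_u` (weighted norms).
[cite: BenfattoGiulianiMastropietro2006, §3 (3.2)-(3.8)] -/
theorem sum_kerProd_sum_wt_patWeight_le (hwt : IsTreeWeight wt) (hK : ∀ v Yv, K v Yv ≠ 0 → ∀ j, cl (Yv j) = v) (Nv : Fin n → ℝ)
    (hN0 : ∀ u, 0 ≤ Nv u)
    (hN : ∀ u (j : Fin (deg u)) (a : Γ), ∑ Yu ∈ univ.filter (fun Yu : Fin (deg u) → Γ => Yu j = a), ‖K u Yu‖ * wt (univ.image Yu) ≤ Nv u)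
    {α : ℝ} (hα : 0 ≤ α) (hrow : ∀ ℓ X, ∑ Y, ‖typeRestrict C cl ℓ X Y‖ * wt {X, Y} ≤ α)
    (hcol : ∀ ℓ Y, ∑ X, ‖typeRestrict C cl ℓ X Y‖ * wt {X, Y} ≤ α)
    {w : Γ} {k : ℕ} (s : Script (cl w) k) (hs : s.Valid) (hcov : univ.image s.y = univ) {r : ℕ} (i : Fin r)
    (π : List (Fin (∑ v, deg v) × Fin (∑ v, deg v))) :
    ∑ Ys : (∀ v, Fin (deg v) → Γ), (∏ u, ‖K u (Ys u)‖) *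
        ∑ W ∈ univ.filter (fun W : Fin r → Γ => W i = w), wt (univ.image W) * patWeight (flat Ys) (scriptOps C cl W s) π ≤
      (if stepsOK (List.replicate r (fun _ => true) ++ s.lines.reverse.map (lapPred deg)) π then 1 else 0) *
        ((α / 2) ^ k * ∏ u, Nv u) := by
  set D := (α / 2) ^ k * ∏ u, Nv u with hD
  have hD0 : 0 ≤ D := mul_nonneg (pow_nonneg (by positivity) _) (prod_nonneg fun u _ => hN0 u)
  have hRHS0 : 0 ≤ (if stepsOK (List.replicate r (fun _ => true) ++ s.lines.reverse.map (lapPred deg)) π then (1 : ℝ) else 0) * D := by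
    split_ifs <;> simp [hD0]
  set laps : List (DelOp Γ 𝕜) := s.lines.reverse.map fun ℓ => DelOp.lap (typeRestrict C cl ℓ) with hlaps
  have h1 : ∀ (Ys : ∀ v, Fin (deg v) → Γ) (W : Fin r → Γ), patWeight (flat Ys) (scriptOps C cl W s) π =
      patWeight (flat Ys) ((List.ofFn W).map DelOp.ext : List (DelOp Γ 𝕜)) (π.take r) * patWeight (flat Ys) laps (π.drop r) := by
    intro Ys W
    rw [scriptOps, patWeight_append, List.length_map, List.length_ofFn]
  have hG0 : ∀ Ys : ∀ v, Fin (deg v) → Γ, 0 ≤ ∏ u, ‖K u (Ys u)‖ := fun Ys => prod_nonneg fun u _ => norm_nonneg _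
  -- too short patterns carry no weight
  by_cases hr : π.length < r
  · refine le_trans (le_of_eq (sum_eq_zero fun Ys _ => ?_)) hRHS0
    rw [sum_eq_zero fun W _ => ?_, mul_zero]
    rw [h1, patWeight_map_ext_eq_zero_of_lt _ W _ (by rw [List.length_take]; exact lt_of_le_of_lt (min_le_right _ _) hr), zero_mul,
      mul_zero]
  have hr' : r ≤ π.length := not_lt.1 hr
  have hi : (i : ℕ) < (π.take r).length := by rw [List.length_take, min_eq_left hr']; exact i.2
  set pq₀ := (π.take r)[(i : ℕ)]'hi with hpq₀
  have hget : (π.take r)[(i : ℕ)]? = some pq₀ := List.getElem?_eq_getElem hi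
  -- the weighted output-label sum
  have h2 : ∀ Ys : ∀ v, Fin (deg v) → Γ, (∏ u, ‖K u (Ys u)‖) * ∑ W ∈ univ.filter (fun W : Fin r → Γ => W i = w),
      wt (univ.image W) * patWeight (flat Ys) (scriptOps C cl W s) π ≤
      (∏ u, ‖K u (Ys u)‖) * (wt (univ.image (flat Ys)) * ((if flat Ys pq₀.1 = w then 1 else 0) * patWeight (flat Ys) laps (π.drop r))) := by
    intro Ys
    refine mul_le_mul_of_nonneg_left ?_ (hG0 Ys)
    simp only [h1, ← mul_assoc]
    rw [← sum_mul]
    refine mul_le_mul_of_nonneg_right ?_ (patWeight_nonneg (flat Ys) laps (π.drop r))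
    have h := sum_filter_wt_mul_patWeight_map_ext_le (𝕜 := 𝕜) hwt (flat Ys) i w (π.take r)
    rw [hget, Option.map_some] at h
    refine h.trans (le_of_eq ?_)
    by_cases ha : flat Ys pq₀.1 = w <;> simp [ha]
  refine (sum_le_sum fun Ys _ => h2 Ys).trans ?_
  -- reindex by position labellings and insert the consistency constraints
  have h3 : ∑ Ys : (∀ v, Fin (deg v) → Γ), (∏ u, ‖K u (Ys u)‖) *
        (wt (univ.image (flat Ys)) * ((if flat Ys pq₀.1 = w then 1 else 0) * patWeight (flat Ys) laps (π.drop r))) =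
      ∑ x : Fin (∑ v, deg v) → Γ, if vert deg pq₀.1 = cl w then
        (if x pq₀.1 = w then wt (univ.image x) * (kerProd K x * lapWt C cl deg s.lines.reverse (π.drop r) x) else 0) else 0 := by
    refine Fintype.sum_equiv (flatEquiv deg) _ _ fun Ys => ?_
    rw [flatEquiv_apply, ← kerProd_flat]
    have hk := kerProd_mul_patWeight_laps C cl K hK (flat Ys) s.lines.reverse (π.drop r)
    have hi' := kerProd_mul_ite_eq cl K hK (flat Ys) pq₀.1 w (1 : ℝ)
    rw [← hlaps] at hk
    by_cases hv : vert deg pq₀.1 = cl w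
    · rw [if_pos hv]
      by_cases hx : flat Ys pq₀.1 = w
      · rw [if_pos hx, if_pos hx, one_mul, mul_left_comm, hk]
      · rw [if_neg hx, if_neg hx, zero_mul, mul_zero, mul_zero]
    · rw [if_neg hv]
      by_cases hx : flat Ys pq₀.1 = w
      · have h0 : kerProd K (flat Ys) = 0 := by
          have h' := hi'
          rw [if_neg hv, if_pos hx, mul_one] at h'
          exact h'
        rw [h0, zero_mul]
      · rw [if_neg hx, zero_mul, mul_zero, mul_zero]
  rw [h3]
  by_cases hv : vert deg pq₀.1 = cl w
  swap
  · simp only [hv, if_false, sum_const_zero]; exact hRHS0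
  simp only [hv, if_true]
  rw [← sum_filter]
  by_cases hc : stepsOK (s.lines.reverse.map (lapPred deg)) (π.drop r) = true
  · rw [stepsOK_append, List.length_replicate, stepsOK_replicate_true, hc, Bool.and_true,
      if_pos (by rw [decide_eq_true_iff, List.length_take, min_eq_left hr']), one_mul]
    exact sum_wt_kerProd_mul_lapWt_le C cl K hwt Nv hN0 hN hα hrow hcol s hs hcov (π.drop r) pq₀.1 hv w
  · refine le_trans (le_of_eq (sum_eq_zero fun x _ => ?_)) hRHS0
    rw [lapWt_eq C cl x _ _ (List.nodup_reverse.2 (Script.nodup_lines s hs)), if_neg hc, mul_zero, mul_zero]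

end TreeDecay

/-! ### One script -/

/-- **One script, weighted** (Benfatto–Giuliani–Mastropietro 2006, (2.77) and §3 for one anchored tree): with the
output slot `i` pinned at `w` and the tree rooted at `cl w`,
`Σ_{W : W_i = w} wt(W) Σ_Y ∏‖K‖ ‖kernel_r (treeFactor s ψ(flat Y)) (W)‖ ≤ (r!)⁻¹ N^{(r)} κ^{N-r-2k} (∏ N_u) (∏_{ℓ ∈ lines} α m m'_ℓ) ∫ w_s`
with `wt`-weighted norms `N_u` and `wt`-weighted row sums `α`. [cite: BenfattoGiulianiMastropietro2006, (2.77)] -/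
theorem sum_wt_sum_norm_kernel_treeFactor_le {E : Type*} [NormedAddCommGroup E] [InnerProductSpace 𝕜 E] (hwt : IsTreeWeight wt)
    (q : Γ → Bool) (hC : ∀ X Y, q X = q Y → C X Y = 0) (f g : Γ → E) {κ : ℝ} (hκ : 0 ≤ κ)
    (hf : ∀ X, q X = true → ‖f X‖ ≤ κ) (hg : ∀ Y, q Y = false → ‖g Y‖ ≤ κ)
    (hG : ∀ X Y, q X = true → q Y = false → contr 𝕜 C X Y = ⟪f X, g Y⟫_𝕜)
    (hK : ∀ v Yv, K v Yv ≠ 0 → ∀ j, cl (Yv j) = v) (Nv : Fin n → ℝ) (hN0 : ∀ u, 0 ≤ Nv u)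
    (hN : ∀ u (j : Fin (deg u)) (a : Γ), ∑ Yu ∈ univ.filter (fun Yu : Fin (deg u) → Γ => Yu j = a), ‖K u Yu‖ * wt (univ.image Yu) ≤ Nv u)
    {α : ℝ} (hα : 0 ≤ α) (hrow : ∀ ℓ X, ∑ Y, ‖typeRestrict C cl ℓ X Y‖ * wt {X, Y} ≤ α)
    (hcol : ∀ ℓ Y, ∑ X, ‖typeRestrict C cl ℓ X Y‖ * wt {X, Y} ≤ α)
    {w : Γ} {k : ℕ} (s : Script (cl w) k) (hs : s.Valid) (hcov : univ.image s.y = univ) {r : ℕ} (i : Fin r) :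
    ∑ W ∈ univ.filter (fun W : Fin r → Γ => W i = w), wt (univ.image W) * ∑ Ys : (∀ v, Fin (deg v) → Γ), (∏ u, ‖K u (Ys u)‖) *
        ‖kernel 𝕜 (((Script.treeFactor (pairLap 𝕜 C cl) s : laplacianAlgebra 𝕜 C cl) : Module.End 𝕜 (GrassmannAlgebra 𝕜 Γ))
          (genProd 𝕜 (flat Ys))) r W‖ ≤
      ((((r.factorial : ℝ))⁻¹ * ((∑ v, deg v).descFactorial r : ℝ)) * κ ^ ((∑ v, deg v) - (r + 2 * k)) * ∏ u, Nv u) *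
        ((s.lines.map fun ℓ => α * (pairDeg deg ℓ : ℝ)).prod * cubeIntegral (Fin n) ℝ (s.weight ℝ)) := by
  set P := patSet (scriptOps C cl (fun _ : Fin r => w) s) (univ : Finset (Fin (∑ v, deg v))) with hP
  set Iw := cubeIntegral (Fin n) ℝ (s.weight ℝ) with hIw
  set c := ((r.factorial : ℝ))⁻¹ with hc
  set e := (∑ v, deg v) - (r + 2 * k) with he
  set D := (α / 2) ^ k * ∏ u, Nv u with hD
  set preds := List.replicate r (fun _ : Fin (∑ v, deg v) × Fin (∑ v, deg v) => true) ++ s.lines.reverse.map (lapPred deg) with hpreds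
  have hIw0 : 0 ≤ Iw := cubeIntegral_nonneg _ fun t ht => FermionicTree.eval_weight_nonneg s ht
  have hc0 : 0 ≤ c := inv_nonneg.2 (Nat.cast_nonneg _)
  have hD0 : 0 ≤ D := mul_nonneg (pow_nonneg (by positivity) _) (prod_nonneg fun u _ => hN0 u)
  have hG0 : ∀ Ys : ∀ v, Fin (deg v) → Γ, 0 ≤ ∏ u, ‖K u (Ys u)‖ := fun Ys => prod_nonneg fun u _ => norm_nonneg _
  -- the Gram bound per output slot and label family
  have h1 : ∀ (W : Fin r → Γ) (Ys : ∀ v, Fin (deg v) → Γ), wt (univ.image W) * ((∏ u, ‖K u (Ys u)‖) *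
      ‖kernel 𝕜 (((Script.treeFactor (pairLap 𝕜 C cl) s : laplacianAlgebra 𝕜 C cl) : Module.End 𝕜 (GrassmannAlgebra 𝕜 Γ))
        (genProd 𝕜 (flat Ys))) r W‖) ≤
      ∑ π ∈ P, (c * κ ^ e * Iw) * ((∏ u, ‖K u (Ys u)‖) * (wt (univ.image W) * patWeight (flat Ys) (scriptOps C cl W s) π)) := by
    intro W Ys
    have h := norm_kernel_treeFactor_genProd_le C cl q hC f g hκ hf hg hG s hs (flat Ys) W
    rw [patSet_scriptOps_eq C cl W (fun _ => w) s, ← hP, ← hc, ← he, ← hIw] at h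
    refine (mul_le_mul_of_nonneg_left (mul_le_mul_of_nonneg_left h (hG0 Ys)) (hwt.nonneg _)).trans (le_of_eq ?_)
    rw [mul_sum, sum_mul, mul_sum, mul_sum]
    exact sum_congr rfl fun π _ => by ring
  -- the admissible patterns and their count
  have hcount : ((P.filter fun π => stepsOK preds π).card : ℝ) ≤
      (((∑ v, deg v).descFactorial r * (s.lines.reverse.map fun ℓ => 2 * pairDeg deg ℓ).prod : ℕ) : ℝ) := by
    set L : List (DelOp Γ 𝕜 × (Fin (∑ v, deg v) × Fin (∑ v, deg v) → Bool) × (ℕ → ℕ)) :=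
      ((List.ofFn fun _ : Fin r => w).map fun X => (DelOp.ext X, (fun _ => true), id)) ++
        (s.lines.reverse.map fun ℓ => (DelOp.lap (typeRestrict C cl ℓ), lapPred deg ℓ, fun _ => 2 * pairDeg deg ℓ)) with hL
    have hfst : L.map Prod.fst = scriptOps C cl (fun _ : Fin r => w) s := by
      rw [hL, List.map_append, List.map_map, List.map_map, scriptOps]; rfl
    have hpred : L.map (fun x => x.2.1) = preds := by
      rw [hL, hpreds, List.map_append, List.map_map, List.map_map, List.map_ofFn]
      exact congrArg₂ _ (List.ofFn_const _ _) rfl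
    have hbd : L.map (fun x => (x.1, x.2.2)) = ((List.ofFn fun _ : Fin r => w).map fun X => ((DelOp.ext X : DelOp Γ 𝕜), id)) ++
        (s.lines.reverse.map fun ℓ => ((DelOp.lap (typeRestrict C cl ℓ) : DelOp Γ 𝕜), fun _ => 2 * pairDeg deg ℓ)) := by
      rw [hL, List.map_append, List.map_map, List.map_map]; rfl
    have hB : ∀ x ∈ L, ∀ S' : Finset (Fin (∑ v, deg v)), ((DelOp.stepSet S' x.1).filter fun pq => x.2.1 pq).card ≤ x.2.2 S'.card := by
      intro x hx S'
      rw [hL, List.mem_append, List.mem_map, List.mem_map] at hx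
      rcases hx with ⟨X, -, rfl⟩ | ⟨ℓ, -, rfl⟩
      · rw [filter_true_of_mem fun _ _ => rfl, DelOp.card_stepSet_ext]
        exact le_rfl
      · exact card_filter_lapPred_le S' _ ℓ
    have h := card_filter_patSet_le L hB univ
    rw [hfst, hpred, hbd, countBound_append, countBound_exts, countBound_consts, card_univ, Fintype.card_fin] at h
    exact_mod_cast h
  -- the per-line factors
  have hprod : (s.lines.map fun ℓ => α * (pairDeg deg ℓ : ℝ)).prod =
      (α / 2) ^ k * (((s.lines.reverse.map fun ℓ => 2 * pairDeg deg ℓ).prod : ℕ) : ℝ) := by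
    rw [Nat.cast_list_prod, List.map_map, List.map_reverse, List.prod_reverse,
      show (fun ℓ => α * (pairDeg deg ℓ : ℝ)) = fun ℓ => (α / 2) * ((Nat.cast : ℕ → ℝ) ∘ fun ℓ => 2 * pairDeg deg ℓ) ℓ from
        funext fun ℓ => by simp only [Function.comp_apply, Nat.cast_mul, Nat.cast_ofNat]; ring,
      List.prod_map_mul, List.map_const', List.prod_replicate, Script.length_lines]
  calc ∑ W ∈ univ.filter (fun W : Fin r → Γ => W i = w), wt (univ.image W) * ∑ Ys : (∀ v, Fin (deg v) → Γ), (∏ u, ‖K u (Ys u)‖) *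
          ‖kernel 𝕜 (((Script.treeFactor (pairLap 𝕜 C cl) s : laplacianAlgebra 𝕜 C cl) : Module.End 𝕜 (GrassmannAlgebra 𝕜 Γ))
            (genProd 𝕜 (flat Ys))) r W‖
      = ∑ W ∈ univ.filter (fun W : Fin r → Γ => W i = w), ∑ Ys : (∀ v, Fin (deg v) → Γ), wt (univ.image W) * ((∏ u, ‖K u (Ys u)‖) *
          ‖kernel 𝕜 (((Script.treeFactor (pairLap 𝕜 C cl) s : laplacianAlgebra 𝕜 C cl) : Module.End 𝕜 (GrassmannAlgebra 𝕜 Γ))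
            (genProd 𝕜 (flat Ys))) r W‖) := sum_congr rfl fun W _ => mul_sum _ _ _
    _ ≤ ∑ W ∈ univ.filter (fun W : Fin r → Γ => W i = w), ∑ Ys : (∀ v, Fin (deg v) → Γ),
          ∑ π ∈ P, (c * κ ^ e * Iw) * ((∏ u, ‖K u (Ys u)‖) * (wt (univ.image W) * patWeight (flat Ys) (scriptOps C cl W s) π)) :=
        sum_le_sum fun W _ => sum_le_sum fun Ys _ => h1 W Ys
    _ = (c * κ ^ e * Iw) * ∑ π ∈ P, ∑ Ys : (∀ v, Fin (deg v) → Γ), (∏ u, ‖K u (Ys u)‖) *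
          ∑ W ∈ univ.filter (fun W : Fin r → Γ => W i = w), wt (univ.image W) * patWeight (flat Ys) (scriptOps C cl W s) π := by
        rw [mul_sum]
        calc ∑ W ∈ univ.filter (fun W : Fin r → Γ => W i = w), ∑ Ys : (∀ v, Fin (deg v) → Γ),
                ∑ π ∈ P, (c * κ ^ e * Iw) * ((∏ u, ‖K u (Ys u)‖) * (wt (univ.image W) * patWeight (flat Ys) (scriptOps C cl W s) π))
            = ∑ Ys : (∀ v, Fin (deg v) → Γ), ∑ W ∈ univ.filter (fun W : Fin r → Γ => W i = w),
                ∑ π ∈ P, (c * κ ^ e * Iw) * ((∏ u, ‖K u (Ys u)‖) * (wt (univ.image W) * patWeight (flat Ys) (scriptOps C cl W s) π)) := sum_comm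
          _ = ∑ Ys : (∀ v, Fin (deg v) → Γ), ∑ π ∈ P, ∑ W ∈ univ.filter (fun W : Fin r → Γ => W i = w),
                (c * κ ^ e * Iw) * ((∏ u, ‖K u (Ys u)‖) * (wt (univ.image W) * patWeight (flat Ys) (scriptOps C cl W s) π)) :=
              sum_congr rfl fun Ys _ => sum_comm
          _ = ∑ π ∈ P, ∑ Ys : (∀ v, Fin (deg v) → Γ), ∑ W ∈ univ.filter (fun W : Fin r → Γ => W i = w),
                (c * κ ^ e * Iw) * ((∏ u, ‖K u (Ys u)‖) * (wt (univ.image W) * patWeight (flat Ys) (scriptOps C cl W s) π)) := sum_comm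
          _ = _ := sum_congr rfl fun π _ => by
              rw [mul_sum]
              refine sum_congr rfl fun Ys _ => ?_
              rw [mul_sum, mul_sum]
    _ ≤ (c * κ ^ e * Iw) * ∑ π ∈ P, (if stepsOK preds π then 1 else 0) * D :=
        mul_le_mul_of_nonneg_left (sum_le_sum fun π _ => sum_kerProd_sum_wt_patWeight_le C cl K hwt hK Nv hN0 hN hα hrow hcol s hs hcov i π)
          (by positivity)
    _ = (c * κ ^ e * Iw) * (((P.filter fun π => stepsOK preds π).card : ℝ) * D) := by
        rw [← sum_mul, ← sum_boole]
    _ ≤ (c * κ ^ e * Iw) * ((((∑ v, deg v).descFactorial r * (s.lines.reverse.map fun ℓ => 2 * pairDeg deg ℓ).prod : ℕ) : ℝ) * D) :=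
        mul_le_mul_of_nonneg_left (mul_le_mul_of_nonneg_right hcount hD0) (by positivity)
    _ = ((c * ((∑ v, deg v).descFactorial r : ℝ)) * κ ^ e * ∏ u, Nv u) *
          ((s.lines.map fun ℓ => α * (pairDeg deg ℓ : ℝ)).prod * Iw) := by
        rw [hprod, hD, Nat.cast_mul]
        ring

/-! ### The weighted bound -/

/-- **The decay-weighted `L¹–L^∞` bound for the kernels of the truncated expectation of kernel vertices**
(Benfatto–Giuliani–Mastropietro 2006, (2.66)–(2.80) with §3 (3.2)–(3.8); Gentile–Mastropietro 2001, §4): for a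
tree weight `wt` on label sets, a charged covariance `C` in Gram form on the mixed pairs with constant `κ` whose
type restrictions have `wt`-weighted row and column sums at most `α`, even kernel vertices `M_v = Σ K_v ψ(·)`
supported on their clusters with `wt`-weighted anchored `L¹` norms `≤ N_v`, and any `λ > 0`: one output label pinned
and the others summed AGAINST THE WEIGHT OF THE OUTPUT LABEL SET,
`Σ_{W : W_i = w} wt(W) ‖kernel_r 𝓔ᵀ_C(M_0,…,M_{n-1}) (W)‖ ≤
  (r!)⁻¹ N^{(r)} κ^{N - r - 2(n-1)} (∏_v N_v) · λ^{-(n-1)} ∏_ℓ (1 + λ α m m'_ℓ)`.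
[cite: BenfattoGiulianiMastropietro2006, (2.66)-(2.80) and §3 (3.2)-(3.8)] -/
theorem sum_wt_norm_kernel_ursellOf_kernelVertex_le {E : Type*} [NormedAddCommGroup E] [InnerProductSpace 𝕜 E] (hwt : IsTreeWeight wt)
    (q : Γ → Bool) (hC : ∀ X Y, q X = q Y → C X Y = 0) (f g : Γ → E) {κ : ℝ} (hκ : 0 ≤ κ)
    (hf : ∀ X, q X = true → ‖f X‖ ≤ κ) (hg : ∀ Y, q Y = false → ‖g Y‖ ≤ κ)
    (hG : ∀ X Y, q X = true → q Y = false → contr 𝕜 C X Y = ⟪f X, g Y⟫_𝕜)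
    (hm : ∀ v, Even (deg v)) (hK : ∀ v Yv, K v Yv ≠ 0 → ∀ j, cl (Yv j) = v) (Nv : Fin n → ℝ) (hN0 : ∀ u, 0 ≤ Nv u)
    (hN : ∀ u (j : Fin (deg u)) (a : Γ), ∑ Yu ∈ univ.filter (fun Yu : Fin (deg u) → Γ => Yu j = a), ‖K u Yu‖ * wt (univ.image Yu) ≤ Nv u)
    {α : ℝ} (hα : 0 ≤ α) (hrow : ∀ ℓ X, ∑ Y, ‖typeRestrict C cl ℓ X Y‖ * wt {X, Y} ≤ α)
    (hcol : ∀ ℓ Y, ∑ X, ‖typeRestrict C cl ℓ X Y‖ * wt {X, Y} ≤ α) {lam : ℝ} (hlam : 0 < lam)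
    {r : ℕ} (i : Fin r) (w : Γ) :
    ∑ W ∈ univ.filter (fun W : Fin r → Γ => W i = w), wt (univ.image W) *
        ‖kernel 𝕜 ((ursellOf (convMoment 𝕜 C (kernelVertex 𝕜 hm K)) univ : evenPart 𝕜 Γ) : GrassmannAlgebra 𝕜 Γ) r W‖ ≤
      ((((r.factorial : ℝ))⁻¹ * ((∑ v, deg v).descFactorial r : ℝ)) * κ ^ ((∑ v, deg v) - (r + 2 * (n - 1))) * ∏ u, Nv u) *
        ((lam⁻¹) ^ (n - 1) * ∏ ℓ : Sym2 (Fin n), (1 + lam * (α * (pairDeg deg ℓ : ℝ)))) := by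
  have hn : 0 < n := Fin.pos (cl w)
  set A := (((r.factorial : ℝ))⁻¹ * ((∑ v, deg v).descFactorial r : ℝ)) with hA
  have hA0 : 0 ≤ A := mul_nonneg (inv_nonneg.2 (Nat.cast_nonneg _)) (Nat.cast_nonneg _)
  set y : Sym2 (Fin n) → ℝ := fun ℓ => α * (pairDeg deg ℓ : ℝ) with hy
  have hy0 : ∀ ℓ, 0 ≤ y ℓ := fun ℓ => mul_nonneg hα (Nat.cast_nonneg _)
  have hNv : 0 ≤ ∏ u, Nv u := prod_nonneg fun u _ => hN0 u
  set Wset := univ.filter (fun W : Fin r → Γ => W i = w) with hWset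
  -- abbreviation for the script terms
  set T : ∀ k : ℕ, Script (cl w) k → (Fin r → Γ) → (∀ v, Fin (deg v) → Γ) → ℝ := fun k s W Ys =>
    ‖kernel 𝕜 (((Script.treeFactor (pairLap 𝕜 C cl) s : laplacianAlgebra 𝕜 C cl) : Module.End 𝕜 (GrassmannAlgebra 𝕜 Γ))
      (genProd 𝕜 (flat Ys))) r W‖ with hT
  calc ∑ W ∈ Wset, wt (univ.image W) * ‖kernel 𝕜 ((ursellOf (convMoment 𝕜 C (kernelVertex 𝕜 hm K)) univ : evenPart 𝕜 Γ) : GrassmannAlgebra 𝕜 Γ) r W‖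
      ≤ ∑ W ∈ Wset, wt (univ.image W) * ∑ Ys : (∀ v, Fin (deg v) → Γ), (∏ u, ‖K u (Ys u)‖) * ∑ k ∈ range n, ∑ s : Script (cl w) k,
          if s.Valid ∧ univ.image s.y = univ then T k s W Ys else 0 :=
        sum_le_sum fun W _ => mul_le_mul_of_nonneg_left (norm_kernel_ursellOf_kernelVertex_le C cl K hm hK (cl w) r W) (hwt.nonneg _)
    _ = ∑ k ∈ range n, ∑ s : Script (cl w) k, ∑ W ∈ Wset, wt (univ.image W) * ∑ Ys : (∀ v, Fin (deg v) → Γ),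
          (∏ u, ‖K u (Ys u)‖) * (if s.Valid ∧ univ.image s.y = univ then T k s W Ys else 0) := by
        calc ∑ W ∈ Wset, wt (univ.image W) * ∑ Ys : (∀ v, Fin (deg v) → Γ), (∏ u, ‖K u (Ys u)‖) * ∑ k ∈ range n, ∑ s : Script (cl w) k,
                (if s.Valid ∧ univ.image s.y = univ then T k s W Ys else 0)
            = ∑ W ∈ Wset, ∑ k ∈ range n, ∑ s : Script (cl w) k, wt (univ.image W) * ∑ Ys : (∀ v, Fin (deg v) → Γ),
                (∏ u, ‖K u (Ys u)‖) * (if s.Valid ∧ univ.image s.y = univ then T k s W Ys else 0) :=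
              sum_congr rfl fun W _ => by
                calc wt (univ.image W) * ∑ Ys : (∀ v, Fin (deg v) → Γ), (∏ u, ‖K u (Ys u)‖) * ∑ k ∈ range n, ∑ s : Script (cl w) k,
                        (if s.Valid ∧ univ.image s.y = univ then T k s W Ys else 0)
                    = ∑ Ys : (∀ v, Fin (deg v) → Γ), ∑ k ∈ range n, ∑ s : Script (cl w) k,
                        wt (univ.image W) * ((∏ u, ‖K u (Ys u)‖) * (if s.Valid ∧ univ.image s.y = univ then T k s W Ys else 0)) := by
                      rw [mul_sum]
                      exact sum_congr rfl fun Ys _ => by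
                        rw [mul_sum, mul_sum]
                        exact sum_congr rfl fun k _ => by rw [mul_sum, mul_sum]
                  _ = ∑ k ∈ range n, ∑ Ys : (∀ v, Fin (deg v) → Γ), ∑ s : Script (cl w) k,
                        wt (univ.image W) * ((∏ u, ‖K u (Ys u)‖) * (if s.Valid ∧ univ.image s.y = univ then T k s W Ys else 0)) := sum_comm
                  _ = ∑ k ∈ range n, ∑ s : Script (cl w) k, ∑ Ys : (∀ v, Fin (deg v) → Γ),
                        wt (univ.image W) * ((∏ u, ‖K u (Ys u)‖) * (if s.Valid ∧ univ.image s.y = univ then T k s W Ys else 0)) :=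
                      sum_congr rfl fun k _ => sum_comm
                  _ = _ := sum_congr rfl fun k _ => sum_congr rfl fun s _ => by rw [mul_sum]
          _ = ∑ k ∈ range n, ∑ W ∈ Wset, ∑ s : Script (cl w) k, wt (univ.image W) * ∑ Ys : (∀ v, Fin (deg v) → Γ),
                (∏ u, ‖K u (Ys u)‖) * (if s.Valid ∧ univ.image s.y = univ then T k s W Ys else 0) := sum_comm
          _ = _ := sum_congr rfl fun k _ => sum_comm
    _ ≤ ∑ k ∈ range n, ∑ s : Script (cl w) k, (if s.Valid ∧ univ.image s.y = univ then
          (A * κ ^ ((∑ v, deg v) - (r + 2 * k)) * ∏ u, Nv u) * ((s.lines.map y).prod * cubeIntegral (Fin n) ℝ (s.weight ℝ)) else 0) := by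
        refine sum_le_sum fun k _ => sum_le_sum fun s _ => ?_
        split_ifs with h
        · exact sum_wt_sum_norm_kernel_treeFactor_le C cl K hwt q hC f g hκ hf hg hG hK Nv hN0 hN hα hrow hcol s h.1 h.2 i
        · simp
    _ = ∑ s : Script (cl w) (n - 1), (if s.Valid ∧ univ.image s.y = univ then
          (A * κ ^ ((∑ v, deg v) - (r + 2 * (n - 1))) * ∏ u, Nv u) * ((s.lines.map y).prod * cubeIntegral (Fin n) ℝ (s.weight ℝ)) else 0) := by
        rw [sum_eq_single (n - 1)]
        · intro k _ hk
          refine sum_eq_zero fun s _ => if_neg ?_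
          rintro ⟨hs, hcov⟩
          have h := Script.card_image_y s hs
          rw [hcov, card_univ, Fintype.card_fin] at h
          omega
        · intro h
          exact absurd (mem_range.2 (by omega)) h
    _ ≤ (A * κ ^ ((∑ v, deg v) - (r + 2 * (n - 1))) * ∏ u, Nv u) * ∑ s : Script (cl w) (n - 1),
          (if s.Valid then (s.lines.map y).prod * cubeIntegral (Fin n) ℝ (s.weight ℝ) else 0) := by
        rw [mul_sum]
        refine sum_le_sum fun s _ => ?_
        have h0 := Script.prod_mul_weight_nonneg s y hy0
        by_cases hv : s.Valid
        · by_cases hc : univ.image s.y = univ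
          · simp [hv, hc]
          · simp only [hv, hc, and_false, if_false, if_true]
            rw [if_pos hv] at h0
            exact mul_nonneg (mul_nonneg (mul_nonneg hA0 (pow_nonneg hκ _)) hNv) h0
        · simp [hv]
    _ ≤ (A * κ ^ ((∑ v, deg v) - (r + 2 * (n - 1))) * ∏ u, Nv u) * ((lam⁻¹) ^ (n - 1) * ∏ ℓ : Sym2 (Fin n), (1 + lam * y ℓ)) :=
        mul_le_mul_of_nonneg_left (sum_prod_mul_weight_le_of_scale y hy0 (cl w) hlam (by rw [Fintype.card_fin]; omega))
          (mul_nonneg (mul_nonneg hA0 (pow_nonneg hκ _)) hNv)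

end Literature.MathematicalPhysics.QuantumLattice
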